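import Literature.MathematicalPhysics.QuantumFieldTheory.BalabanImbrieJaffe1984to88.BIJ88RT52BlockGauge
import Literature.MathematicalPhysics.QuantumFieldTheory.BalabanImbrieJaffe1984to88.BIJ88RT51Background42

/-!
# `BalabanImbrieJaffe1984to88.BIJ88Eq529PrevPhases` — T. Bałaban, J. Imbrie, A. Jaffe, *Effective action and cluster properties of the
abelian Higgs model*, Commun. Math. Phys. **114** (1988) 257–315 [BalabanImbrieJaffe1988], (5.2.9) p. 279 [PDF 23], fifth map (with (4.17)
p. 277 [PDF 21]): **the PRINTED transformation of the earlier fields `u^{(j)}` in the restricted block field gauge invariance (5.2.9)** —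
*"u_b^{(j)} → u_b^{(j)} exp(−ie_kL^jη(∂^{L^jη}Q′*_{k−j+1}λ)(b)), b ∈ Λ₁^{(j)*c} only"* — TYPED WITH BODY as a prescription of `U(1)` phase
factors `phase529 Λ₁ y g` (bondwise right multiplication, gen 5's measurable equivalence `BIJ88RT51NoChange.mulRightPrev`), hence
`Π𝒟u^{(j)}`-PRESERVING (gen 5's `measurePreserving_mulRightPrev`), its printed exponential form CERTIFIED against r18's typed (4.17)
`BIJ88Sect4Statements.blockGaugeUj` (`Q′*` = pull-back along the block map, non-empty exempt set), and the abstract reparametrization `τ` of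
this seat's (5.2.9) theorems INSTANTIATED with it: file 3's `isRD_blockGauge_axial`/`density528_blockGauge` and gen 7's
`isRT511Ax_blockGauge_background`, with the background `u_k` entering through the concrete kernel `Q(ū_k)φ` and bond products `ū_k` of (4.4)
and — for the (4.2)-shaped backgrounds and the printed `Qu` — EVERY transformation law discharged (`density528_blockGauge_printed`).
(File 5 of seat p34 gen 8; answer to the row owner's request HOME/lit-balaban-p34/INBOX.md 2026-08-21T19:17:32Z *"an instantiation (τ := the
printed phases, Haar-preserving, with the background laws for the concrete u_k of §4–5)"*.)

statement-level skeleton of published theorems with citation tags; proofs where landed; nothing here is a claim about the Yang–Mills mass gap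

PDF held: `paper:balaban1988-cmp114-bij-abelian-higgs-effective-action` (journal page = PDF page + 256); pp. 274, 277–279 [PDF 18, 21–23] read
(`lit read … --pages 17-25`; r16's renders `HOME/lit-balaban-r16/renders/cmp114/original-p023-x2.png`).

CITATION HEADER (lean-in-tree rule).  Part of the lit-balaban TYPED SKELETON (HOME `run/shared/lean/pub/lit-balaban/`), PHASE-2 proof seat
p34 gen 8 (unit `lit-balaban-p34-g8`; TAKING line HOME/STATUS.md 2026-08-21T19:32:01Z; own lineage = the C1/C2 renormalization-transformation
line).  Rows served (support): **`C2.Eq5.2.9`** (owner r16; typed `BIJ88Sect5StatementsPart3.Invariant529`; members gen 5 `BIJ88RT51BlockGauge`,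
gen 8 `BIJ88RT52BlockGauge` p300532), `C2.Eq4.17` (owner r18; gen 5 `BIJ88RT51NoChange.mulRightPrev`), `C2.Eq5.2.6-5.2.8` ((5.2.8): p299755 +
p300110).

THE PRINTED TEXT (p. 279 [PDF 23], verbatim).  *"Let us remark that having imposed the axial gauge conditions, we resign from all but the
following restricted block field gauge invariance: ψ_y → ψ_y e^{ie_kλ(y)}, φ_x → φ_x e^{ie_k(Q′*λ)(x)}, v_{b′} → v_{b′} e^{−ie_kL(∂^Lλ)(b′)}, u_b →
u_b e^{−ie_k(∂Q′*λ)(b)}, u_b^{(j)} → u_b^{(j)} exp(−ie_kL^jη(∂^{L^jη}Q′*_{k−j+1}λ)(b)), b ∈ Λ₁^{(j)*c} only. (5.2.9) These transformations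
represent exactly the gauge invariance that was not broken by the axial gauge conditions but was broken by the renormalization
transformation. By compensating with transformations of the block fields v, ψ, we again have an invariance. This restricted gauge invariance
we intend to preserve in all subsequent operations. For example, it is easily seen that the characteristic functions we have inserted are
invariant."*  p. 277 [PDF 21]: *"Here Q′_k denotes the averaging operator for real-valued functions on sites. … The dependence of u_k and u and
the u^{(j)} is such that the above transformations induce the gauge transformation u_{k,b} → u_{k,b} exp[−ie_kη(∂^ηQ′*_kλ)], and thus we have
invariance in the previous sense."*

READING (group level, as r18's `BIJ88BlockGauge417` and this seat's gens 5–8).  `λ` on the block lattice `T_L^{(k+1)}` ↔ `g = e^{ie_kλ} :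
T_L^{(k+1)} → U(1)`.  `Q′*_{k−j+1}λ = λ∘y_j` is the pull-back of `λ` along the `(k+1−j)`-fold block map `y_j : T^{(j)} → T_L^{(k+1)}` (r18's
`sitePairing_siteAvg`, iterated; `y_j` = `B1RG242Torus.proj (k+1) (k+1−j)` = `B7SectAStatements.blockOfIter (k+1−j)`), and
`L^jη·(∂^{L^jη}f)(b) = f(b₊) − f(b₋)`, so the printed factor is `exp(−ie_k[λ(y_j(b₊)) − λ(y_j(b₋))]) = g(y_j(b₋))·g(y_j(b₊))⁻¹ ∈ U(1)` on the bonds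
`b ∈ Λ₁^{(j)*c}` and `1` on the exempt bonds `b ∈ Λ₁^{(j)*}` — the transformation multiplies `u_b^{(j)}` by a PRESCRIBED group element, i.e. it
is gen 5's `mulRightPrev` of the prescription `phase529 Λ₁ y g` (equivalently, `U(1)` being abelian, the gauge transformation of `u^{(j)}` by
`g∘y_j` restricted to `Λ₁^{(j)*c}`: `mulRightPrev_phase529_apply`).  The exempt bond sets `Λ₁^{(j)*}` (per term: they are data of the term's
regions) and the block maps `y_j` are DATA of the theorems — every statement below holds for all of them, in particular for the printed ones.

WHAT IS PROVED (kernel-checked; one `def` with body (`phase529`), theorems otherwise; NO `Prop`-valued fact; standard axioms).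
* §1 `phase529` and its API: the printed cases (`phase529_of_mem/_of_not_mem`, `mulRightPrev_phase529_apply`), the group law
  (`phase529_one/_mul`, `mulRightPrev_phase529_one/_mul`: the fifth maps represent the gauge functions of `T_L^{(k+1)}`), **the printed exponential
  form** `toC_phase529` (`= exp[−ie_kξ(∂^ξ(λ∘y_j))(b)]`, any spacing `ξ ≠ 0`, print `ξ = L^jη`) and **the dictionary with the typed (4.17)**:
  `cfg_mulRightPrev_phase529` — read in `ℂ`, the fifth map IS r18's `blockGaugeUj e_k ξ (pull-back along y_j) Λ₁^{(j)*} λ`;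
  `measurePreserving_mulRightPrev_phase529` (`Π𝒟u^{(j)}` is preserved — gen 5, recorded here for the instance).
* §2 **(5.2.9) with the printed fifth map**: `isRD_blockGauge_axial_phase529` (file 3's covariance theorem for the `ψ`-dependent display over
  `𝒟u δ_{Ax}` with `τ_t(g) := mulRightPrev (phase529 (Λ₁ t) y g)`), `isRT511Ax_blockGauge_phase529` (gen 7's (5.1.1) covariance with the
  concrete kernel `Q(ū(u_k))φ`, same `τ`), `isRT511Ax_blockGauge_printed` ((5.1.1)+(5.1.4) with the printed `Qu`, the printed fifth map and
  the (4.2)-shaped backgrounds: only the `ρ′_t`-invariance assumed).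
* §3 **(5.2.9) for the (5.2.8) density with the printed fifth map and the background through `ū_k`**: `density528_blockGauge_phase529` — the
  kernel `Q(u_k)φ := qCov (barU k u_k) φ` and the bond products `ū_k := cfg (barU k u_k)` of the printed characteristic functions are computed
  from background MAPS `u_k = uk_t({u^{(j)}}, u)` (p. 274 *"It depends on all the u^{(j)}"*) whose only hypothesis is the printed induced law of
  p. 277 under the printed transformation (`uk_t(τ_t(g){u^{(j)}}, u^{g∘y}) = uk_t({u^{(j)}}, u)^{λ₀}`, `λ₀` restricting to `g∘y` on the points of
  `T₁^{(k)}`); the laws of `Q(ū_k)φ` (`↦ g·Q(ū_k)φ`) and of `ū_k` (`ū_b ↦ g(y(b₋))ū_bg(y(b₊))⁻¹`) are DERIVED (gen 7's `qCov_barU_blockGauge`,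
  `barU_gaugeAct`); and **`density528_blockGauge_printed`**: with the PRINTED `Qu` ([2] (2.10), r18's `qU`, covariant by r18's
  `qU_gaugeAct_blockConst`) and the (4.2)-SHAPED backgrounds `u_k = bg42 k w_t u` of gen 7 (law `bg42_gaugeAct`), every transformation law is
  discharged: if `ρ̃` satisfies the (5.2.8) display, so does `(v, ψ) ↦ ρ̃(v^g, gψ)`, the only hypotheses left being the invariance of the term
  densities `ρ′_t` under the printed maps and the gauge invariance of the correction factors `w_t` (the printed one is: gen 7's
  `gaugeInvariant_expCorr`).
NOT DONE HERE (honest scope).  The form of `u_k` outside `Λ̄₆^{(k−1)*}` (*"quite complicated"*, p. 274 — not printed; §3 keeps it a map with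
the printed law as hypothesis), hence no discharge of the `ρ′_t`-invariance (the `ρ′_k` of (5.1.1) are inductive data); the identification
`y_j = blockOfIter (k+1−j)` is not used by any proof (data); any bound.  Imports `BIJ88RT52BlockGauge` (file 3) and gen 7's
`BIJ88RT51Background42` (Literature + Mathlib only); re-declares nothing.
-/

namespace Literature.MathematicalPhysics.QuantumFieldTheory.BalabanImbrieJaffe1984to88.BIJ88Eq529PrevPhases

open Literature.MathematicalPhysics.QuantumFieldTheory.Balaban1983to89
open BIJ88Sect3Statements (U1 toC toC_mul toC_one cfg)
open BIJ88Sect3Rescaling (toC_injective_U1)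
open BIJ85Sect1Model (HiggsField)
open BIJ85RT33 (twist)
open BIJ88RenormTransf311 (axialMeasure)
open BIJ85BlockAveragesTorus (qU qCov expU1 toC_expU1 toC_inv' toC_gaugeAct)
open BIJ88InductiveForm41 (Prev prevMeasure)
open BIJ88Sect4Statements (barU blockGaugeUj)
open BIJ88BlockGauge417 (qU_gaugeAct_blockConst)
open BIJ88RT51GeneralStep (IsRT511Ax)
open BIJ88RT51NoChange (mulRightPrev mulRightPrev_apply measurePreserving_mulRightPrev)
open BIJ88RT51Background (barU_gaugeAct qCov_barU_blockGauge iterBlockOf_embIter isRT511Ax_blockGauge_background)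
open BIJ88RT51Background42 (bg42 bg42_gaugeAct isRT511Ax_blockGauge_bg42)
open BIJ88RT52Restrictions (IsRD)
open BIJ88RT52BlockGauge (isRD_blockGauge_axial density528_blockGauge)
open BIJ88Eq528Density (Point Coeff522 chi522 weight527)
open BIJ88Sect5Statements (CutoffProfile)
open B15DeterminingSets (embIter)
open B5Eq118OneStroke (iterBlockOf)
open GaugeField (gaugeAct GaugeInvariant)
open scoped BigOperators
open _root_.MeasureTheory Complex

noncomputable section

variable {P : Params} {k : ℕ}

/-! ## §1 The printed phase factors of the fifth map of (5.2.9) -/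

/-- **The phase factors of the fifth map of (5.2.9)** p. 279 [PDF 23] — *"u_b^{(j)} → u_b^{(j)} exp(−ie_kL^jη(∂^{L^jη}Q′*_{k−j+1}λ)(b)), b ∈
Λ₁^{(j)*c} only"* — at group level: for `g = e^{ie_kλ}` on `T_L^{(k+1)}`, block maps `y_j : T^{(j)} → T_L^{(k+1)}` (`Q′*_{k−j+1}λ = λ∘y_j`) and
exempt bond sets `Λ₁^{(j)*}`, the factor multiplying `u_b^{(j)}` is `g(y_j(b₋))·g(y_j(b₊))⁻¹` (`= exp(−ie_k[λ(y_j(b₊)) − λ(y_j(b₋))])`,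
`toC_phase529`) off `Λ₁^{(j)*}` and `1` on it; the map itself is gen 5's `mulRightPrev (phase529 Λ₁ y g)`.
[cite: BalabanImbrieJaffe1988, (5.2.9) p.279] -/
def phase529 (Λ1 : (j : Fin k) → Finset (PBond P j))
    (y : (j : Fin k) → Balaban1983to89.Site P j → Balaban1983to89.Site P (k+1)) (g : GaugeTransf P (k+1) U1) :
    (j : Fin k) → PBond P j → U1 :=
  fun j b => if b ∈ Λ1 j then 1 else g (y j b.src) * (g (y j b.tgt))⁻¹

section Phase

variable (Λ1 : (j : Fin k) → Finset (PBond P j)) (y : (j : Fin k) → Balaban1983to89.Site P j → Balaban1983to89.Site P (k+1))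

/-- printed case *"b ∈ Λ₁^{(j)*c} only"*: on the exempt bonds the factor is `1`. [cite: BalabanImbrieJaffe1988, (5.2.9) p.279] -/
theorem phase529_of_mem (g : GaugeTransf P (k+1) U1) {j : Fin k} {b : PBond P j} (hb : b ∈ Λ1 j) : phase529 Λ1 y g j b = 1 := by
  simp [phase529, hb]

/-- printed case: off the exempt set the factor is `g(y_j(b₋))·g(y_j(b₊))⁻¹`. [cite: BalabanImbrieJaffe1988, (5.2.9) p.279] -/
theorem phase529_of_not_mem (g : GaugeTransf P (k+1) U1) {j : Fin k} {b : PBond P j} (hb : b ∉ Λ1 j) :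
    phase529 Λ1 y g j b = g (y j b.src) * (g (y j b.tgt))⁻¹ := by
  simp [phase529, hb]

/-- kernel: `U(1)` is commutative (read in `ℂ`). [folklore] -/
private theorem mul_comm_U1 (a b : U1) : a * b = b * a :=
  toC_injective_U1 (by rw [toC_mul, toC_mul, mul_comm])

/-- `λ = 0` (`g = 1`): all factors are `1`. [cite: BalabanImbrieJaffe1988, (5.2.9) p.279] -/
theorem phase529_one (j : Fin k) (b : PBond P j) : phase529 Λ1 y (fun _ => (1 : U1)) j b = 1 := by
  by_cases hb : b ∈ Λ1 j <;> simp [phase529, hb]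

/-- **group law**: the factors are multiplicative in `g` (`λ ↦ e^{ie_kλ}` is a homomorphism and `U(1)` is abelian), so the fifth maps of (5.2.9)
represent the group of gauge functions on `T_L^{(k+1)}` (`mulRightPrev_phase529_mul`). [cite: BalabanImbrieJaffe1988, (5.2.9) p.279] -/
theorem phase529_mul (g₁ g₂ : GaugeTransf P (k+1) U1) (j : Fin k) (b : PBond P j) :
    phase529 Λ1 y (fun z => g₁ z * g₂ z) j b = phase529 Λ1 y g₁ j b * phase529 Λ1 y g₂ j b := by
  by_cases hb : b ∈ Λ1 j
  · simp [phase529, hb]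
  · simp only [phase529, hb, if_false]
    apply toC_injective_U1
    simp only [toC_mul, toC_inv', mul_inv]
    ring

/-- the fifth map for `λ = 0` is the identity. [cite: BalabanImbrieJaffe1988, (5.2.9) p.279] -/
theorem mulRightPrev_phase529_one (prev : Prev P k) : mulRightPrev (phase529 Λ1 y (fun _ => (1 : U1))) prev = prev := by
  funext j b
  rw [mulRightPrev_apply, phase529_one, mul_one]

/-- the fifth maps compose as the gauge functions multiply (a group action on the earlier fields). [cite: BalabanImbrieJaffe1988, (5.2.9) p.279] -/
theorem mulRightPrev_phase529_mul (g₁ g₂ : GaugeTransf P (k+1) U1) (prev : Prev P k) :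
    mulRightPrev (phase529 Λ1 y (fun z => g₁ z * g₂ z)) prev = mulRightPrev (phase529 Λ1 y g₂) (mulRightPrev (phase529 Λ1 y g₁) prev) := by
  funext j b
  simp only [mulRightPrev_apply, phase529_mul, mul_assoc]

/-- **The fifth map of (5.2.9) acts as printed**: `u_b^{(j)} ↦ u_b^{(j)}` on `Λ₁^{(j)*}`, and off it `u_b^{(j)} ↦ g(y_j(b₋)) u_b^{(j)} g(y_j(b₊))⁻¹` —
the gauge transformation of `u^{(j)}` by the block-constant `g∘y_j`, restricted to `Λ₁^{(j)*c}` (`U(1)` abelian).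
[cite: BalabanImbrieJaffe1988, (5.2.9) p.279] -/
theorem mulRightPrev_phase529_apply (g : GaugeTransf P (k+1) U1) (prev : Prev P k) (j : Fin k) (b : PBond P j) :
    mulRightPrev (phase529 Λ1 y g) prev j b =
      if b ∈ Λ1 j then prev j b else g (y j b.src) * prev j b * (g (y j b.tgt))⁻¹ := by
  rw [mulRightPrev_apply, phase529]
  split_ifs with hb
  · exact mul_one _
  · rw [← mul_assoc, mul_comm_U1 (prev j b) (g (y j b.src))]

/-- **The printed exponential form**: for `g = e^{ie_kλ}` and `b ∉ Λ₁^{(j)*}`, the factor is `exp[−ie_kξ(∂^ξ(λ∘y_j))(b)]` for every spacing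
`ξ ≠ 0` (print: `ξ = L^jη`; `∂^ξ` = `LatticeFieldCalculus.grad ξ⁻¹`, `λ∘y_j = Q′*_{k−j+1}λ`). [cite: BalabanImbrieJaffe1988, (5.2.9) p.279] -/
theorem toC_phase529 {ξ : ℝ} (hξ : ξ ≠ 0) (ek : ℝ) (lam : Balaban1983to89.Site P (k+1) → ℝ) {j : Fin k} {b : PBond P j} (hb : b ∉ Λ1 j) :
    toC (phase529 Λ1 y (fun z => expU1 (ek * lam z)) j b) =
      exp (-(I * (ek * ξ * LatticeFieldCalculus.grad ξ⁻¹ (fun x => lam (y j x)) b : ℝ))) := by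
  rw [phase529_of_not_mem Λ1 y _ hb, toC_mul, toC_inv', toC_expU1, toC_expU1]
  simp only [LatticeFieldCalculus.grad, smul_eq_mul]
  rw [show ek * ξ * (ξ⁻¹ * (lam (y j b.tgt) - lam (y j b.src))) = ek * (lam (y j b.tgt) - lam (y j b.src)) by field_simp]
  rw [← Complex.exp_neg, ← Complex.exp_add]
  congr 1
  push_cast
  ring

/-- **Dictionary with the typed (4.17)** (r18's decl of record `BIJ88Sect4Statements.blockGaugeUj`): read in `ℂ`, the fifth map of (5.2.9)
applied to `u^{(j)}` IS `blockGaugeUj e_k ξ Q′* Λ₁^{(j)*} λ` with `Q′*` the pull-back along `y_j` and the (non-empty) exempt set `Λ₁^{(j)*}`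
(any `ξ ≠ 0`; r18's `blockGaugeUj_eq_cfg_gaugeAct` is the case `Λ₁^{(j)*} = ∅`, one level). [cite: BalabanImbrieJaffe1988, (4.17) p.277] -/
theorem cfg_mulRightPrev_phase529 {ξ : ℝ} (hξ : ξ ≠ 0) (ek : ℝ) (lam : Balaban1983to89.Site P (k+1) → ℝ) (prev : Prev P k) (j : Fin k) :
    cfg (mulRightPrev (phase529 Λ1 y (fun z => expU1 (ek * lam z))) prev j) =
      blockGaugeUj ek ξ (fun (μ : Balaban1983to89.Site P (k+1) → ℝ) (x : Balaban1983to89.Site P j) => μ (y j x)) (Λ1 j) lam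
        (cfg (prev j)) := by
  funext b
  change toC (prev j b * phase529 Λ1 y (fun z => expU1 (ek * lam z)) j b) = _
  by_cases hb : b ∈ Λ1 j
  · simp only [phase529_of_mem Λ1 y _ hb, mul_one, blockGaugeUj, hb, if_true, cfg]
  · rw [toC_mul, toC_phase529 Λ1 y hξ ek lam hb]
    simp only [blockGaugeUj, hb, if_false, cfg]

/-- **`Π𝒟u^{(j)}` is preserved by the fifth map of (5.2.9)** (right invariance of the normalized Haar measures, bond by bond: gen 5's
`measurePreserving_mulRightPrev` for the printed prescription). [cite: BalabanImbrieJaffe1988, (5.2.9) p.279] -/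
theorem measurePreserving_mulRightPrev_phase529 (g : GaugeTransf P (k+1) U1) :
    MeasurePreserving (mulRightPrev (phase529 Λ1 y g)) (prevMeasure P k) (prevMeasure P k) :=
  measurePreserving_mulRightPrev _

end Phase

/-! ## §2 (5.2.9) with the printed fifth map -/

section Covariance

variable {ι : Type*} {terms : Finset ι} {Qu : GaugeField P k U1 → GaugeField P (k+1) U1}
variable {Qφ : ι → Prev P k → GaugeField P k U1 → HiggsField P k → HiggsField P (k+1)} {a : ℝ}
variable {ρ : ι → Prev P k → GaugeField P k U1 → HiggsField P k → HiggsField P (k+1) → ℂ}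
variable {ρ' : ι → Prev P k → GaugeField P k U1 → HiggsField P k → ℂ}
variable {ρL : GaugeField P (k+1) U1 → HiggsField P (k+1) → ℂ}

/-- **(5.2.9) for the `ψ`-dependent display over `∫𝒟u δ_{Ax}(u)(·)` with the PRINTED fifth map** (file 3's `isRD_blockGauge_axial` with
`τ_t(g) := mulRightPrev (phase529 (Λ₁ t) y g)` — exempt sets per term, any block maps; its measure preservation is now a theorem, not a
hypothesis): block-gauge covariant `Qu`, integrand `ρ_t` invariant and kernel `Q_t` covariant under `(u, {u^{(j)}}, φ, ψ) ↦ (u^{g∘y},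
{u^{(j)}·phase529}, (g∘y)φ, gψ)` ⟹ `(v, ψ) ↦ ρ̃(v^g, gψ)` satisfies the display whenever `ρ̃` does (standing range).
[cite: BalabanImbrieJaffe1988, (5.2.9) p.279] -/
theorem isRD_blockGauge_axial_phase529 (hk : k + 1 ≤ P.m + P.K)
    (hQu : ∀ (g : GaugeTransf P (k+1) U1) U, Qu (gaugeAct (fun x => g (blockOf x)) U) = gaugeAct g (Qu U))
    (Λ1 : ι → (j : Fin k) → Finset (PBond P j)) (y : (j : Fin k) → Balaban1983to89.Site P j → Balaban1983to89.Site P (k+1))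
    (hρ : ∀ t ∈ terms, ∀ (g : GaugeTransf P (k+1) U1) prev U φ ψ,
      ρ t (mulRightPrev (phase529 (Λ1 t) y g) prev) (gaugeAct (fun x => g (blockOf x)) U) (twist (fun x => g (blockOf x)) φ)
        (twist g ψ) = ρ t prev U φ ψ)
    (hQφ : ∀ t ∈ terms, ∀ (g : GaugeTransf P (k+1) U1) prev U φ,
      Qφ t (mulRightPrev (phase529 (Λ1 t) y g) prev) (gaugeAct (fun x => g (blockOf x)) U) (twist (fun x => g (blockOf x)) φ) =
        twist g (Qφ t prev U φ))
    (h : IsRD (axialMeasure P k U1) terms Qu Qφ a ρ ρL) (g : GaugeTransf P (k+1) U1) :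
    IsRD (axialMeasure P k U1) terms Qu Qφ a ρ (fun v ψ => ρL (gaugeAct g v) (twist g ψ)) :=
  isRD_blockGauge_axial hk hQu (fun t g => mulRightPrev (phase529 (Λ1 t) y g))
    (fun t _ g => measurePreserving_mulRightPrev_phase529 (Λ1 t) y g) hρ hQφ h g

/-- **(5.2.9)/(4.17) for (5.1.1) with the printed fifth map and the concrete kernel `Q(ū(u_k))φ`** (gen 7's
`isRT511Ax_blockGauge_background` with `τ_t(g) := mulRightPrev (phase529 (Λ₁ t) y g)`): block-gauge covariant `Qu`, `ρ′_t` invariant under the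
printed maps, and background maps `uk_t` obeying the printed induced law of p. 277 (`uk_t` of the transformed fields is the gauge transform of
`uk_t` by a `λ₀` of `T_η` restricting to `g∘y` on the points of `T₁^{(k)}`) ⟹ `(v, ψ) ↦ ρ̃(v^g, gψ)` satisfies (5.1.1)+(5.1.4) whenever `ρ̃`
does (standing range). [cite: BalabanImbrieJaffe1988, (4.17) p.277] -/
theorem isRT511Ax_blockGauge_phase529 (hk : k + 1 ≤ P.m + P.K)
    (hQu : ∀ (g : GaugeTransf P (k+1) U1) U, Qu (gaugeAct (fun x => g (blockOf x)) U) = gaugeAct g (Qu U))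
    (Λ1 : ι → (j : Fin k) → Finset (PBond P j)) (y : (j : Fin k) → Balaban1983to89.Site P j → Balaban1983to89.Site P (k+1))
    (hρ : ∀ t ∈ terms, ∀ (g : GaugeTransf P (k+1) U1) prev U φ,
      ρ' t (mulRightPrev (phase529 (Λ1 t) y g) prev) (gaugeAct (fun x => g (blockOf x)) U) (twist (fun x => g (blockOf x)) φ) =
        ρ' t prev U φ)
    {uk : ι → Prev P k → GaugeField P k U1 → GaugeField P 0 U1} (H : ι → GaugeTransf P (k+1) U1 → GaugeTransf P 0 U1)
    (hH : ∀ t ∈ terms, ∀ (g : GaugeTransf P (k+1) U1) (x : Balaban1983to89.Site P k), H t g (embIter k x) = g (blockOf x))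
    (huk : ∀ t ∈ terms, ∀ (g : GaugeTransf P (k+1) U1) prev U,
      uk t (mulRightPrev (phase529 (Λ1 t) y g) prev) (gaugeAct (fun x => g (blockOf x)) U) = gaugeAct (H t g) (uk t prev U))
    (h : IsRT511Ax terms Qu (fun t prev U φ => qCov (barU k (uk t prev U)) φ) a ρ' ρL) (g : GaugeTransf P (k+1) U1) :
    IsRT511Ax terms Qu (fun t prev U φ => qCov (barU k (uk t prev U)) φ) a ρ' (fun v ψ => ρL (gaugeAct g v) (twist g ψ)) :=
  isRT511Ax_blockGauge_background hk hQu (fun t g => mulRightPrev (phase529 (Λ1 t) y g))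
    (fun t _ g => measurePreserving_mulRightPrev_phase529 (Λ1 t) y g) hρ H hH huk h g

/-- **(5.1.1)+(5.1.4): block field gauge covariance, FULLY PRINTED renormalization side** — the printed `Qu` (r18's `qU`), the printed fifth
map, the (4.2)-shaped backgrounds `u_k = bg42 k w_t u` with gauge-invariant `w_t` (gen 7's `isRT511Ax_blockGauge_bg42` with `τ_t(g) :=
mulRightPrev (phase529 (Λ₁ t) y g)`): only the invariance of the `ρ′_t` under the printed maps is assumed (standing range).
[cite: BalabanImbrieJaffe1988, (4.17) p.277] -/
theorem isRT511Ax_blockGauge_printed (hk : k + 1 ≤ P.m + P.K)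
    (Λ1 : ι → (j : Fin k) → Finset (PBond P j)) (y : (j : Fin k) → Balaban1983to89.Site P j → Balaban1983to89.Site P (k+1))
    (hρ : ∀ t ∈ terms, ∀ (g : GaugeTransf P (k+1) U1) prev U φ,
      ρ' t (mulRightPrev (phase529 (Λ1 t) y g) prev) (gaugeAct (fun x => g (blockOf x)) U) (twist (fun x => g (blockOf x)) φ) =
        ρ' t prev U φ)
    {w : ι → GaugeField P k U1 → GaugeField P 0 U1} (hw : ∀ t ∈ terms, GaugeInvariant (w t))
    (h : IsRT511Ax terms qU (fun t _ U φ => qCov (barU k (bg42 k (w t) U)) φ) a ρ' ρL) (g : GaugeTransf P (k+1) U1) :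
    IsRT511Ax terms qU (fun t _ U φ => qCov (barU k (bg42 k (w t) U)) φ) a ρ' (fun v ψ => ρL (gaugeAct g v) (twist g ψ)) :=
  isRT511Ax_blockGauge_bg42 hk hw (fun g U => qU_gaugeAct_blockConst hk g U) (fun t g => mulRightPrev (phase529 (Λ1 t) y g))
    (fun t _ g => measurePreserving_mulRightPrev_phase529 (Λ1 t) y g) hρ h g

end Covariance

/-! ## §3 (5.2.9) for the (5.2.8) density: printed fifth map, background through `ū_k` -/

section Density

variable {ι ιp : Type*} [DecidableEq ιp] {terms : Finset ι} {Qu : GaugeField P k U1 → GaugeField P (k+1) U1} {a : ℝ}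
variable {ρ' : ι → Prev P k → GaugeField P k U1 → HiggsField P k → ℂ} {ρL : GaugeField P (k+1) U1 → HiggsField P (k+1) → ℂ}

/-- kernel: **the induced law of `ū_k`** — if the background map transforms by a `λ₀` of `T_η` restricting to `g∘y` on the points of `T₁^{(k)}`,
the bond products (4.4) transform as `ū_b ↦ g(y(b₋)) ū_b g(y(b₊))⁻¹` (gen 7's `barU_gaugeAct`, read in `ℂ`; standing range).
[cite: BalabanImbrieJaffe1988, (4.17) p.277] -/
theorem cfg_barU_transf (hk : k ≤ P.m + P.K) (g : GaugeTransf P (k+1) U1) {h : GaugeTransf P 0 U1}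
    (hh : ∀ x : Balaban1983to89.Site P k, h (embIter k x) = g (blockOf x)) (W : GaugeField P 0 U1) :
    cfg (barU k (gaugeAct h W)) = fun b => toC (g (blockOf b.src)) * cfg (barU k W) b * (toC (g (blockOf b.tgt)))⁻¹ := by
  funext b
  rw [barU_gaugeAct k hk h W]
  change toC (gaugeAct (fun y => h (embIter k y)) (barU k W) b) = _
  rw [toC_gaugeAct, hh, hh]
  rfl

/-- **(5.2.9) FOR THE (5.2.8) DENSITY with the PRINTED fifth map and the background entering through `ū_k`** (file 3's `density528_blockGauge`,
`τ_t(g) := mulRightPrev (phase529 (Λ₁ t) y g)`, the kernel `Q(u_k)φ := qCov (barU k u_k) φ` and the bond products `ū_k := cfg (barU k u_k)` of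
the printed `χ_y`, `χ_b` computed from background maps `u_k = uk_t({u^{(j)}}, u)`): if `Qu` is block-gauge covariant, the `ρ′_t` are invariant
under the printed maps and the `uk_t` obey the printed induced law of p. 277, then every `ρ̃` satisfying the display (5.2.8) (file 2's data)
over `𝒟u δ_{Ax}` transforms covariantly — `(v, ψ) ↦ ρ̃(v^g, gψ)` satisfies the same display; the laws of `Q(ū_k)φ` and `ū_k` used by file 3 are
DERIVED here (standing range). [cite: BalabanImbrieJaffe1988, (5.2.9) p.279] -/
theorem density528_blockGauge_phase529 (hk : k + 1 ≤ P.m + P.K)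
    (hQu : ∀ (g : GaugeTransf P (k+1) U1) U, Qu (gaugeAct (fun x => g (blockOf x)) U) = gaugeAct g (Qu U))
    (Λ1 : ι → (j : Fin k) → Finset (PBond P j)) (y : (j : Fin k) → Balaban1983to89.Site P j → Balaban1983to89.Site P (k+1))
    (hρ : ∀ t ∈ terms, ∀ (g : GaugeTransf P (k+1) U1) prev U φ,
      ρ' t (mulRightPrev (phase529 (Λ1 t) y g) prev) (gaugeAct (fun x => g (blockOf x)) U) (twist (fun x => g (blockOf x)) φ) =
        ρ' t prev U φ)
    {uk : ι → Prev P k → GaugeField P k U1 → GaugeField P 0 U1} (H : ι → GaugeTransf P (k+1) U1 → GaugeTransf P 0 U1)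
    (hH : ∀ t ∈ terms, ∀ (g : GaugeTransf P (k+1) U1) (x : Balaban1983to89.Site P k), H t g (embIter k x) = g (blockOf x))
    (huk : ∀ t ∈ terms, ∀ (g : GaugeTransf P (k+1) U1) prev U,
      uk t (mulRightPrev (phase529 (Λ1 t) y g) prev) (gaugeAct (fun x => g (blockOf x)) U) = gaugeAct (H t g) (uk t prev U))
    (χ : CutoffProfile) (c : Coeff522) (S : ι → Finset ιp) (pt : ι → ιp → Point P k) (Rmap : ι → Finset ιp → Finset ιp)
    (h : IsRD (axialMeasure P k U1) (terms.sigma fun t => (S t).powerset.image (Rmap t)) Qu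
      (fun tr prev U φ => qCov (barU k (uk tr.1 prev U)) φ) a
      (fun tr prev U φ ψ =>
        (weight527 (S tr.1) (Rmap tr.1)
            (fun i => chi522 χ c (fun prev U φ => qCov (barU k (uk tr.1 prev U)) φ) (fun prev U => cfg (barU k (uk tr.1 prev U)))
              (pt tr.1 i)) tr.2 prev U φ ψ : ℂ) * ρ' tr.1 prev U φ) ρL)
    (g : GaugeTransf P (k+1) U1) :
    IsRD (axialMeasure P k U1) (terms.sigma fun t => (S t).powerset.image (Rmap t)) Qu
      (fun tr prev U φ => qCov (barU k (uk tr.1 prev U)) φ) a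
      (fun tr prev U φ ψ =>
        (weight527 (S tr.1) (Rmap tr.1)
            (fun i => chi522 χ c (fun prev U φ => qCov (barU k (uk tr.1 prev U)) φ) (fun prev U => cfg (barU k (uk tr.1 prev U)))
              (pt tr.1 i)) tr.2 prev U φ ψ : ℂ) * ρ' tr.1 prev U φ)
      (fun v ψ => ρL (gaugeAct g v) (twist g ψ)) :=
  density528_blockGauge (Qφ := fun t prev U φ => qCov (barU k (uk t prev U)) φ) (ubar := fun t prev U => cfg (barU k (uk t prev U)))
    hk hQu (fun t g => mulRightPrev (phase529 (Λ1 t) y g)) (fun t _ g => measurePreserving_mulRightPrev_phase529 (Λ1 t) y g) hρ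
    (fun t ht g prev U φ => by
      show qCov (barU k (uk t (mulRightPrev (phase529 (Λ1 t) y g) prev) (gaugeAct (fun x => g (blockOf x)) U)))
          (twist (fun x => g (blockOf x)) φ) = twist g (qCov (barU k (uk t prev U)) φ)
      rw [huk t ht g prev U]
      exact qCov_barU_blockGauge hk g (hH t ht g) (uk t prev U) φ)
    χ c
    (fun t ht g prev U => by
      show cfg (barU k (uk t (mulRightPrev (phase529 (Λ1 t) y g) prev) (gaugeAct (fun x => g (blockOf x)) U))) = _
      rw [huk t ht g prev U]
      exact cfg_barU_transf (by omega) g (hH t ht g) (uk t prev U))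
    S pt Rmap h g

/-- **(5.2.9) FOR THE (5.2.8) DENSITY, FULLY PRINTED RENORMALIZATION SIDE**: the printed `Qu` ([2] (2.10), r18's `qU` — covariant:
`qU_gaugeAct_blockConst`), the printed fifth map `mulRightPrev (phase529 (Λ₁ t) y g)`, and the (4.2)-shaped backgrounds `u_k = bg42 k w_t u =
(Q^{s*}_ku)·w_t(u)` of `Λ̄₆^{(k−1)*}` with gauge-invariant correction factors `w_t` (gen 7's `bg42_gaugeAct`: *"u_k transforms by Q′*_kλ"*, here
`λ = g∘y`): EVERY transformation law is discharged — if `ρ̃` satisfies the display (5.2.8) with the printed characteristic functions and the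
`ρ′_t` are invariant under the printed maps, then `(v, ψ) ↦ ρ̃(v^g, gψ)` satisfies the same display (standing range).
[cite: BalabanImbrieJaffe1988, (5.2.9) p.279] -/
theorem density528_blockGauge_printed (hk : k + 1 ≤ P.m + P.K)
    (Λ1 : ι → (j : Fin k) → Finset (PBond P j)) (y : (j : Fin k) → Balaban1983to89.Site P j → Balaban1983to89.Site P (k+1))
    (hρ : ∀ t ∈ terms, ∀ (g : GaugeTransf P (k+1) U1) prev U φ,
      ρ' t (mulRightPrev (phase529 (Λ1 t) y g) prev) (gaugeAct (fun x => g (blockOf x)) U) (twist (fun x => g (blockOf x)) φ) =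
        ρ' t prev U φ)
    {w : ι → GaugeField P k U1 → GaugeField P 0 U1} (hw : ∀ t ∈ terms, GaugeInvariant (w t))
    (χ : CutoffProfile) (c : Coeff522) (S : ι → Finset ιp) (pt : ι → ιp → Point P k) (Rmap : ι → Finset ιp → Finset ιp)
    (h : IsRD (axialMeasure P k U1) (terms.sigma fun t => (S t).powerset.image (Rmap t)) qU
      (fun tr _ U φ => qCov (barU k (bg42 k (w tr.1) U)) φ) a
      (fun tr prev U φ ψ =>
        (weight527 (S tr.1) (Rmap tr.1)
            (fun i => chi522 χ c (fun _ U φ => qCov (barU k (bg42 k (w tr.1) U)) φ) (fun _ U => cfg (barU k (bg42 k (w tr.1) U)))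
              (pt tr.1 i)) tr.2 prev U φ ψ : ℂ) * ρ' tr.1 prev U φ) ρL)
    (g : GaugeTransf P (k+1) U1) :
    IsRD (axialMeasure P k U1) (terms.sigma fun t => (S t).powerset.image (Rmap t)) qU
      (fun tr _ U φ => qCov (barU k (bg42 k (w tr.1) U)) φ) a
      (fun tr prev U φ ψ =>
        (weight527 (S tr.1) (Rmap tr.1)
            (fun i => chi522 χ c (fun _ U φ => qCov (barU k (bg42 k (w tr.1) U)) φ) (fun _ U => cfg (barU k (bg42 k (w tr.1) U)))
              (pt tr.1 i)) tr.2 prev U φ ψ : ℂ) * ρ' tr.1 prev U φ)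
      (fun v ψ => ρL (gaugeAct g v) (twist g ψ)) :=
  density528_blockGauge_phase529 (uk := fun t _ U => bg42 k (w t) U) hk (fun g U => qU_gaugeAct_blockConst hk g U) Λ1 y hρ
    (fun _ g => fun x => g (blockOf (iterBlockOf k x)))
    (fun t _ g x => congrArg (fun z => g (blockOf z)) (iterBlockOf_embIter k (by omega) x))
    (fun t ht g _ U => bg42_gaugeAct (by omega) (hw t ht) (fun x => g (blockOf x)) U) χ c S pt Rmap h g

end Density

end

end Literature.MathematicalPhysics.QuantumFieldTheory.BalabanImbrieJaffe1984to88.BIJ88Eq529PrevPhases
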